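import Literature.NumberTheory.LFunctions.VinogradovZetaSumBound
import Literature.NumberTheory.LFunctions.VinogradovZetaSumShift
import Literature.NumberTheory.LFunctions.VinogradovMeanValueHypothesis
import Literature.NumberTheory.LFunctions.ExpSumBoundReduction
import HarnessLib

/-!
# The Vinogradov–Korobov estimate for the zeta sums from Vinogradov's mean value theorem
# (Ivić 1985, Theorem 6.2), and the Vinogradov–Korobov zero-free region from it

Topic `Literature/NumberTheory/LFunctions`.  Everything in this file is PROVED; no definitions, no named facts.

**Theorem 6.2** of A. Ivić, *The Riemann Zeta-Function* (Wiley 1985): uniformly in `N < N₁ ≤ 2N ≤ t`,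
`∑_{N < n ≤ N₁} n^{it} ≪ N exp(−log³N/(100000 log²t))`.  Here it is proved — for the shifted sums
`∑ (n + u)^{-it}`, `0 < u ≤ 1`, in the range `t ≥ N^{10.5}` (Vinogradov's range; the complementary range of
bounded `λ = log t/log N` is van der Corput's, `ExpSumBoundReduction.lean`), with an unspecified constant in the
exponent — from Vinogradov's mean value theorem in the form of Ivić's Lemma 6.3 with any constant `A ≥ 1`
(the hypothesis `hV`, literally `VMVTBound A` of `VinogradovMeanValueHypothesis.lean`):

* `VinogradovZetaSum.vinogradovRangeBound_of_vmvtInstance` — the same conclusion from the ONE instance `ρ = 6n`,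
  `k = 7n²` of the mean value theorem that the proof uses (so that any form of the mean value theorem feeds it), and
  `VinogradovZetaSum.hasVKZeroFreeRegion_of_vmvtInstance`;
* `VinogradovZetaSum.vinogradovRangeBound_of_vmvt` — **`hV ⟹ ∃ C c > 0, VinogradovRangeBound 10 C c`**:
  `‖∑_{N<n≤R} (n+u)^{-it}‖ ≤ C N^{1 − c (log N)²/(log t)²}` for `1 ≤ N < R ≤ 2N`, `N^{10.5} ≤ t`, `0 < u ≤ 1`;
* `VinogradovZetaSum.hasVKZeroFreeRegion_of_vmvt` (and `…_of_vmvtBound`, the same with the hypothesis packaged as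
  `VMVTBound A`) — hence (`hasVKZeroFreeRegion_of_vinogradovRange`) the
  Vinogradov–Korobov zero-free region `∃ c > 0, HasVKZeroFreeRegion c 21` for all Dirichlet `L`-functions, the
  input of the twisted prime number theorem, of Matomäki–Radziwiłł–Tao (1.12) and Theorem 1.3, of Tao's
  logarithmically averaged Chowla, of Lichtman's theorem — all of which are thereby reduced to Vinogradov's mean
  value theorem (Ivić, Lemmas 6.1–6.3; `VinogradovMeanValueCount.lean`, `VinogradovMeanValueStepA.lean`, …).

Proof of the first item (Ivić pp. 121–124): for `log N ≥ ℓ₀(A)` and `10.5 ≤ Y = log t/log N ≤ √(log N)` combine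
`VinogradovZetaSum.norm_zetaSum_le_shift` (`a = ⌊N^{2/5}⌋`, `r = ⌊5.05Y⌋ + 1`) with `VinogradovZetaSum.U_bound`:
`|S| ≤ N e^{−ℓ/(2·10⁶Y²)} + 2Nt(a²/N)^{r+1} + 2a² ≤ 5N e^{−ℓ/(2·10⁶Y²)} = 5 N^{1 − c log²N/log²t}`, `c = 1/(2·10⁶)`;
for `Y > √(log N)` the claim is weaker than the trivial bound `|S| ≤ N` (`e^{−c} ≤ N^{-c/Y²}`), and so it is for
`log N < ℓ₀` (constant `C = N₀ + 5`).

## References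
* A. Ivić, *The Riemann Zeta-Function*, John Wiley & Sons 1985 (Dover 2003), §6.3, Theorem 6.2 and its proof.
  [cite: Ivic1985, Theorem 6.2]
* K. Ford, Proc. London Math. Soc. 85 (2002), Theorem 2 (the shape `VinogradovRangeBound` / `ExpSumBound`).
  [cite: Ford2002, Theorem 2]
-/

noncomputable section

open Finset Real Filter Complex

namespace Literature.NumberTheory.LFunctions
namespace VinogradovZetaSum

open VdC (e)

/-- The trivial bound `‖∑_{N<n≤R} (n+u)^{-it}‖ ≤ R − N` (`N ≤ R`). [folklore] -/
theorem norm_zetaSum_le_sub {N R : ℕ} (hNR : N ≤ R) {u : ℝ} (hu : 0 < u) (t : ℝ) :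
    ‖∑ n ∈ Finset.Ioc N R, ((n : ℂ) + u) ^ (-(t * I))‖ ≤ (R : ℝ) - N := by
  calc ‖∑ n ∈ Finset.Ioc N R, ((n : ℂ) + u) ^ (-(t * I))‖ ≤ ∑ n ∈ Finset.Ioc N R, ‖((n : ℂ) + u) ^ (-(t * I))‖ :=
        norm_sum_le _ _
    _ = ∑ _n ∈ Finset.Ioc N R, (1 : ℝ) := by
        refine sum_congr rfl fun n _ => ?_
        rw [natCast_add_cpow_eq_e hu, VdC.norm_e]
    _ = (R : ℝ) - N := by
        rw [sum_const, nsmul_eq_mul, mul_one, Nat.card_Ioc, Nat.cast_sub hNR]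

/-- The target `N^{1 − c log²N/log²t}` is at least `1` when `1 ≤ N ≤ t` and `c ≤ 1`. [folklore] -/
theorem one_le_rpow_target {N : ℕ} {t c : ℝ} (hN : 1 ≤ N) (hNt : (N : ℝ) ≤ t) (hc1 : c ≤ 1) :
    1 ≤ (N : ℝ) ^ (1 - c * Real.log N ^ 2 / Real.log t ^ 2) := by
  have hN1 : (1 : ℝ) ≤ N := by exact_mod_cast hN
  refine Real.one_le_rpow hN1 ?_
  have hlogN : 0 ≤ Real.log N := Real.log_nonneg hN1
  have hlogt : Real.log N ≤ Real.log t := Real.log_le_log (by linarith) hNt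
  have hratio : Real.log N ^ 2 / Real.log t ^ 2 ≤ 1 := by
    rcases eq_or_ne (Real.log t) 0 with h0 | h0
    · rw [h0]; simp
    · rw [div_le_one (by positivity)]
      exact pow_le_pow_left₀ hlogN hlogt 2
  have : c * Real.log N ^ 2 / Real.log t ^ 2 ≤ 1 := by
    rw [mul_div_assoc]
    calc c * (Real.log N ^ 2 / Real.log t ^ 2) ≤ 1 * 1 :=
          mul_le_mul hc1 hratio (by positivity) (by norm_num)
      _ = 1 := by norm_num
  linarith

/-- `N^{1 − c ℓ²/T²} = N e^{−c ℓ/(T/ℓ)²}` for `ℓ = log N > 0`, `T ≠ 0`. [folklore] -/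
theorem rpow_target_eq {N : ℕ} {ℓ T : ℝ} (c : ℝ) (hℓ : Real.log N = ℓ) (hℓ0 : 0 < ℓ) (hT : T ≠ 0) :
    (N : ℝ) ^ (1 - c * ℓ ^ 2 / T ^ 2) = (N : ℝ) * Real.exp (-(c * ℓ / (T / ℓ) ^ 2)) := by
  have hℓne : ℓ ≠ 0 := hℓ0.ne'
  have hN0 : (0 : ℝ) < N := by
    by_contra h
    push Not at h
    have : (N : ℝ) = 0 := le_antisymm h (Nat.cast_nonneg N)
    rw [this, Real.log_zero] at hℓ; linarith
  rw [Real.rpow_def_of_pos hN0, hℓ]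
  conv_rhs => rw [← Real.exp_log hN0, hℓ, ← Real.exp_add]
  congr 1
  field_simp
  ring

set_option maxHeartbeats 1600000 in
/-- **Ivić, Theorem 6.2, from ONE instance of Vinogradov's mean value theorem** — the form of
`vinogradovRangeBound_of_vmvt` whose hypothesis `hV` is only the instance `ρ = 6n`, `k = 7n²` that the proof uses:
`J_{7n²,n}([1,P]) ≤ (An)^{42An³} P^{14n² − ½(n²+n)(1 − (1−1/n)^{6n})}` for `n ≥ 2`, `P ≥ (An)^{An(1+1/(n−1))^{6n}}`
(`A ≥ 1`; supplied by any proof of the mean value theorem — Ivić's Lemma 6.3, Ford's Theorem 3, efficient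
congruencing).  Conclusion: `∃ C ≥ 0, c > 0, VinogradovRangeBound 10 C c`. [cite: Ivic1985, Theorem 6.2] -/
theorem vinogradovRangeBound_of_vmvtInstance {A : ℝ} (hA : 1 ≤ A)
    (hV : ∀ (n P : ℕ), 2 ≤ n → (A * n) ^ (A * n * (1 + 1 / ((n : ℝ) - 1)) ^ (6 * n)) ≤ (P : ℝ) →
      (VMV.J n (7 * n ^ 2) (Finset.Icc (1 : ℤ) P) : ℝ) ≤
        (A * n) ^ (A * ((7 * n ^ 2 : ℕ) : ℝ) * ((6 * n : ℕ) : ℝ)) *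
          (P : ℝ) ^ (2 * ((7 * n ^ 2 : ℕ) : ℝ) - ((n : ℝ) ^ 2 + n) / 2 * (1 - (1 - 1 / (n : ℝ)) ^ (6 * n)))) :
    ∃ C c : ℝ, 0 ≤ C ∧ 0 < c ∧ VinogradovRangeBound 10 C c := by
  -- the threshold `ℓ₀` and `N₀`
  obtain ⟨ℓ₀, hℓ₀⟩ := Filter.eventually_atTop.1 (eventually_conditions hA)
  set N₀ : ℕ := ⌈Real.exp (max ℓ₀ 1)⌉₊ with hN₀
  refine ⟨(N₀ : ℝ) + 5, 1 / 2000000, by positivity, by norm_num, ?_⟩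
  intro N R t u hN hNt hu0 hu1 hNR hR2
  have hN1 : (1 : ℝ) ≤ N := by exact_mod_cast hN
  have hN0 : (0 : ℝ) < N := by linarith
  have hRN : (R : ℝ) - N ≤ N := by
    have : (R : ℝ) ≤ 2 * N := by exact_mod_cast hR2
    linarith
  have htN : (N : ℝ) ≤ t := by
    refine le_trans ?_ hNt
    calc (N : ℝ) = (N : ℝ) ^ (1 : ℝ) := (Real.rpow_one _).symm
      _ ≤ (N : ℝ) ^ (((10 : ℕ) : ℝ) + 1 / 2) := Real.rpow_le_rpow_of_exponent_le hN1 (by norm_num)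
  have ht1 : 1 ≤ t := hN1.trans htN
  have ht0 : 0 < t := by linarith
  have htriv : ‖∑ n ∈ Finset.Ioc N R, ((n : ℂ) + u) ^ (-(t * I))‖ ≤ N :=
    (norm_zetaSum_le_sub hNR.le hu0 t).trans hRN
  have htarget1 : 1 ≤ (N : ℝ) ^ (1 - 1 / 2000000 * Real.log N ^ 2 / Real.log t ^ 2) :=
    one_le_rpow_target hN htN (by norm_num)
  have hN₀0 : (0 : ℝ) ≤ N₀ := Nat.cast_nonneg _
  -- ### Case 1: `N < N₀`
  rcases lt_or_ge N N₀ with hsmall | hlarge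
  · have : (N : ℝ) ≤ N₀ := by exact_mod_cast hsmall.le
    calc ‖∑ n ∈ Finset.Ioc N R, ((n : ℂ) + u) ^ (-(t * I))‖ ≤ N := htriv
      _ ≤ ((N₀ : ℝ) + 5) * 1 := by linarith
      _ ≤ ((N₀ : ℝ) + 5) * (N : ℝ) ^ (1 - 1 / 2000000 * Real.log N ^ 2 / Real.log t ^ 2) := by
          gcongr
  -- ### Case 2: `N ≥ N₀`, so `ℓ = log N ≥ max ℓ₀ 1`
  set ℓ : ℝ := Real.log N with hℓdef
  have hℓ_ge : max ℓ₀ 1 ≤ ℓ := by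
    have h1 : Real.exp (max ℓ₀ 1) ≤ N₀ := Nat.le_ceil _
    have h2 : (N₀ : ℝ) ≤ N := by exact_mod_cast hlarge
    rw [hℓdef, ← Real.log_exp (max ℓ₀ 1)]
    exact Real.log_le_log (Real.exp_pos _) (h1.trans h2)
  have hℓ1 : 1 ≤ ℓ := le_trans (le_max_right _ _) hℓ_ge
  have hℓ0 : 0 < ℓ := by linarith
  obtain ⟨c1, c2, c3, c4, c5, c6⟩ := hℓ₀ ℓ (le_trans (le_max_left _ _) hℓ_ge)
  have hNexp : (N : ℝ) = Real.exp ℓ := by rw [hℓdef, Real.exp_log hN0]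
  -- `T = log t ≥ 10.5 ℓ`, `Y = T/ℓ ≥ 10.5`
  set T : ℝ := Real.log t with hTdef
  have hT : 10.5 * ℓ ≤ T := by
    have h1 := Real.log_le_log (by positivity) hNt
    rw [Real.log_rpow hN0] at h1
    rw [hTdef, hℓdef]
    norm_num at h1 ⊢
    linarith
  have hT0 : 0 < T := by linarith
  have hℓne : ℓ ≠ 0 := hℓ0.ne'
  set Y : ℝ := T / ℓ with hYdef
  have hYℓ : Y * ℓ = T := by rw [hYdef]; field_simp
  have hY : 10.5 ≤ Y := by rw [hYdef, le_div_iff₀ hℓ0]; linarith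
  have hY0 : 0 < Y := by linarith
  -- the final shape of the target
  have htarget : (N : ℝ) ^ (1 - 1 / 2000000 * ℓ ^ 2 / T ^ 2) =
      (N : ℝ) * Real.exp (-(1 / 2000000 * ℓ / Y ^ 2)) := by
    rw [hYdef]
    exact rpow_target_eq (1 / 2000000) hℓdef.symm hℓ0 hT0.ne'
  -- ### Case 2a: `Y² > ℓ` — the claim is weaker than the trivial bound
  rcases lt_or_ge ℓ (Y ^ 2) with hYbig | hY2
  · have hE : Real.exp (-(1 : ℝ)) ≤ Real.exp (-(1 / 2000000 * ℓ / Y ^ 2)) := by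
      rw [Real.exp_le_exp, neg_le_neg_iff, div_le_iff₀ (by positivity)]
      nlinarith
    have hE2 : (1 : ℝ) / 5 ≤ Real.exp (-(1 : ℝ)) := by
      rw [Real.exp_neg]
      have := Real.exp_one_lt_d9
      rw [le_inv_comm₀ (by norm_num) (Real.exp_pos 1)]
      norm_num; linarith
    rw [htarget]
    calc ‖∑ n ∈ Finset.Ioc N R, ((n : ℂ) + u) ^ (-(t * I))‖ ≤ N := htriv
      _ = 5 * ((N : ℝ) * (1 / 5)) := by ring
      _ ≤ ((N₀ : ℝ) + 5) * ((N : ℝ) * Real.exp (-(1 / 2000000 * ℓ / Y ^ 2))) := by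
          gcongr
          · linarith
          · exact hE2.trans hE
  -- ### Case 2b: the main case
  set a : ℕ := ⌊(N : ℝ) ^ (2 / 5 : ℝ)⌋₊ with ha
  set r : ℕ := ⌊5.05 * Y⌋₊ + 1 with hr
  -- facts on `a`
  have hxexp : (N : ℝ) ^ (2 / 5 : ℝ) = Real.exp (0.4 * ℓ) := by
    rw [hNexp, ← Real.exp_mul]; ring_nf
  have hax : (a : ℝ) ≤ Real.exp (0.4 * ℓ) := by rw [ha, ← hxexp]; exact Nat.floor_le (by positivity)
  have hx2 : 2 ≤ Real.exp (0.4 * ℓ) := by have := Real.add_one_le_exp (0.4 * ℓ); linarith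
  have ha_half : Real.exp (0.4 * ℓ) / 2 ≤ a := by
    have : Real.exp (0.4 * ℓ) - 1 ≤ a := by rw [ha, ← hxexp]; exact (Nat.sub_one_lt_floor _).le
    linarith
  have ha1r : (1 : ℝ) ≤ a := by linarith
  have ha1 : 1 ≤ a := by exact_mod_cast ha1r
  have ha0 : (0 : ℝ) < a := by linarith
  have ha0' : (a : ℝ) ≠ 0 := ha0.ne'
  have ha2N : 2 * (a : ℝ) ^ 2 ≤ N := by
    have h1 : (a : ℝ) ^ 2 ≤ Real.exp (0.8 * ℓ) := by
      calc (a : ℝ) ^ 2 ≤ (Real.exp (0.4 * ℓ)) ^ 2 := pow_le_pow_left₀ ha0.le hax 2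
        _ = Real.exp (0.8 * ℓ) := by rw [← Real.exp_nat_mul]; ring_nf
    have h2 : 2 ≤ Real.exp (0.2 * ℓ) := by have := Real.add_one_le_exp (0.2 * ℓ); linarith
    have h3 : Real.exp (0.8 * ℓ) * Real.exp (0.2 * ℓ) = N := by rw [hNexp, ← Real.exp_add]; ring_nf
    nlinarith [Real.exp_pos (0.8 * ℓ)]
  have ha2N' : 2 * a ^ 2 ≤ N := by exact_mod_cast ha2N
  -- facts on `r`
  have hr_gt : 5.05 * Y < r := by rw [hr]; push_cast; exact Nat.lt_floor_add_one _
  -- ### the shift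
  have hshift := norm_zetaSum_le_shift r hN hNR hR2 ht0.le hu0 ha1 ha2N'
  -- ### `U(n) ≤ a² E` for every `n ∈ (N, R]`
  set E : ℝ := Real.exp (-(ℓ / (2000000 * Y ^ 2))) with hE
  have hU : ∀ n ∈ Finset.Ioc N R,
      ‖∑ x ∈ Finset.Icc (1 : ℤ) a, ∑ y ∈ Finset.Icc (1 : ℤ) a,
        e (∑ j : Fin r, ((-1) ^ (j.val + 1) * t / (2 * π * ((j.val : ℝ) + 1) * ((n : ℝ) + u) ^ (j.val + 1))) *
          ((x : ℝ) ^ (j.val + 1) * (y : ℝ) ^ (j.val + 1)))‖ ≤ (a : ℝ) ^ 2 * E := by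
    intro n hn
    rw [Finset.mem_Ioc] at hn
    exact U_bound_of_instance hA hV hℓdef.symm hYℓ ht1 hn.1 (hn.2.trans hR2) hu0 hu1 hY hY2 hr ha c1 c2 c3 c4 c5 c6
  -- ### the three terms
  have hE0 : 0 < E := Real.exp_pos _
  have hterm1 : 1 / (a : ℝ) ^ 2 * ∑ n ∈ Finset.Ioc N R,
      ‖∑ x ∈ Finset.Icc (1 : ℤ) a, ∑ y ∈ Finset.Icc (1 : ℤ) a,
        e (∑ j : Fin r, ((-1) ^ (j.val + 1) * t / (2 * π * ((j.val : ℝ) + 1) * ((n : ℝ) + u) ^ (j.val + 1))) *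
          ((x : ℝ) ^ (j.val + 1) * (y : ℝ) ^ (j.val + 1)))‖ ≤ N * E := by
    calc _ ≤ 1 / (a : ℝ) ^ 2 * ∑ _n ∈ Finset.Ioc N R, (a : ℝ) ^ 2 * E := by
          gcongr with n hn
          exact hU n hn
      _ = ((Finset.Ioc N R).card : ℝ) * E := by
          rw [sum_const, nsmul_eq_mul]
          have h2 : (a : ℝ) ^ 2 ≠ 0 := pow_ne_zero 2 ha0'
          calc 1 / (a : ℝ) ^ 2 * (((Finset.Ioc N R).card : ℝ) * ((a : ℝ) ^ 2 * E))
              = ((Finset.Ioc N R).card : ℝ) * E * ((a : ℝ) ^ 2 / (a : ℝ) ^ 2) := by ring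
            _ = ((Finset.Ioc N R).card : ℝ) * E := by rw [div_self h2, mul_one]
      _ ≤ N * E := by
          gcongr
          rw [Nat.card_Ioc]; omega
  have hterm2 : 2 * N * t * ((a : ℝ) ^ 2 / N) ^ (r + 1) ≤ 2 * N * E := by
    have h1 : (a : ℝ) ^ 2 / N ≤ Real.exp (-(0.2 * ℓ)) := by
      rw [div_le_iff₀ hN0, hNexp]
      calc (a : ℝ) ^ 2 ≤ (Real.exp (0.4 * ℓ)) ^ 2 := pow_le_pow_left₀ ha0.le hax 2
        _ = Real.exp (-(0.2 * ℓ)) * Real.exp ℓ := by rw [← Real.exp_nat_mul, ← Real.exp_add]; ring_nf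
    have h2 : ((a : ℝ) ^ 2 / N) ^ (r + 1) ≤ Real.exp (-(0.2 * ((r : ℝ) + 1) * ℓ)) := by
      calc ((a : ℝ) ^ 2 / N) ^ (r + 1) ≤ (Real.exp (-(0.2 * ℓ))) ^ (r + 1) :=
            pow_le_pow_left₀ (by positivity) h1 _
        _ = Real.exp (-(0.2 * ((r : ℝ) + 1) * ℓ)) := by rw [← Real.exp_nat_mul]; push_cast; ring_nf
    have htexp : t = Real.exp (Y * ℓ) := by rw [hYℓ, hTdef, Real.exp_log ht0]
    have h3 : t * ((a : ℝ) ^ 2 / N) ^ (r + 1) ≤ E := by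
      calc t * ((a : ℝ) ^ 2 / N) ^ (r + 1) ≤ Real.exp (Y * ℓ) * Real.exp (-(0.2 * ((r : ℝ) + 1) * ℓ)) := by
            rw [htexp]; gcongr
        _ = Real.exp (Y * ℓ - 0.2 * ((r : ℝ) + 1) * ℓ) := by rw [← Real.exp_add]; ring_nf
        _ ≤ E := by
            rw [hE, Real.exp_le_exp]
            have hr1 : 1.01 * Y ≤ 0.2 * ((r : ℝ) + 1) := by linarith
            have h4 : ℓ / (2000000 * Y ^ 2) ≤ 0.01 * Y * ℓ := by
              rw [div_le_iff₀ (by positivity)]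
              have hY2' : 110.25 ≤ Y ^ 2 := by nlinarith
              have hY3 : 1157.625 ≤ Y ^ 3 := by nlinarith [mul_le_mul hY hY2' (by norm_num) hY0.le]
              have := mul_le_mul_of_nonneg_right hY3 hℓ0.le
              nlinarith
            have h5 := mul_le_mul_of_nonneg_right hr1 hℓ0.le
            linarith
    have := mul_le_mul_of_nonneg_left h3 (by positivity : (0 : ℝ) ≤ 2 * N)
    linarith
  have hterm3 : 2 * (a : ℝ) ^ 2 ≤ 2 * N * E := by
    have h1 : (a : ℝ) ^ 2 ≤ N * Real.exp (-(0.2 * ℓ)) := by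
      calc (a : ℝ) ^ 2 ≤ (Real.exp (0.4 * ℓ)) ^ 2 := pow_le_pow_left₀ ha0.le hax 2
        _ = Real.exp ℓ * Real.exp (-(0.2 * ℓ)) := by rw [← Real.exp_nat_mul, ← Real.exp_add]; ring_nf
        _ = N * Real.exp (-(0.2 * ℓ)) := by rw [hNexp]
    have h2 : Real.exp (-(0.2 * ℓ)) ≤ E := by
      rw [hE, Real.exp_le_exp, neg_le_neg_iff, div_le_iff₀ (by positivity)]
      have h21 : (1 : ℝ) ≤ 0.2 * (2000000 * Y ^ 2) := by nlinarith
      have := mul_le_mul_of_nonneg_left h21 hℓ0.le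
      linarith
    have := mul_le_mul_of_nonneg_left h2 hN0.le
    linarith
  -- ### conclusion
  rw [htarget]
  have hEE : Real.exp (-(1 / 2000000 * ℓ / Y ^ 2)) = E := by
    rw [hE]; congr 1; ring
  rw [hEE]
  calc ‖∑ n ∈ Finset.Ioc N R, ((n : ℂ) + u) ^ (-(t * I))‖ ≤ _ := hshift
    _ ≤ N * E + 2 * N * E + 2 * N * E := add_le_add_three hterm1 hterm2 hterm3
    _ = 5 * ((N : ℝ) * E) := by ring
    _ ≤ ((N₀ : ℝ) + 5) * ((N : ℝ) * E) := by gcongr; linarith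

/-- **The Vinogradov–Korobov zero-free region for Dirichlet `L`-functions from ONE instance of Vinogradov's mean
value theorem** (`ρ = 6n`, `k = 7n²`, as in `vinogradovRangeBound_of_vmvtInstance`): `∃ c > 0, HasVKZeroFreeRegion c 21`.
[cite: Ivic1985, Theorem 6.2] [cite: Ford2002, Theorem 2] -/
theorem hasVKZeroFreeRegion_of_vmvtInstance {A : ℝ} (hA : 1 ≤ A)
    (hV : ∀ (n P : ℕ), 2 ≤ n → (A * n) ^ (A * n * (1 + 1 / ((n : ℝ) - 1)) ^ (6 * n)) ≤ (P : ℝ) →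
      (VMV.J n (7 * n ^ 2) (Finset.Icc (1 : ℤ) P) : ℝ) ≤
        (A * n) ^ (A * ((7 * n ^ 2 : ℕ) : ℝ) * ((6 * n : ℕ) : ℝ)) *
          (P : ℝ) ^ (2 * ((7 * n ^ 2 : ℕ) : ℝ) - ((n : ℝ) ^ 2 + n) / 2 * (1 - (1 - 1 / (n : ℝ)) ^ (6 * n)))) :
    ∃ c : ℝ, 0 < c ∧ HasVKZeroFreeRegion c 21 := by
  obtain ⟨C, c, hC, hc, h⟩ := vinogradovRangeBound_of_vmvtInstance hA hV
  exact hasVKZeroFreeRegion_of_vinogradovRange (K := 10) (by norm_num) hC hc h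

set_option maxHeartbeats 1600000 in
/-- **Ivić, Theorem 6.2, from Vinogradov's mean value theorem** (Vinogradov's range `t ≥ N^{10.5}`, shifted sums):
if `J_{k,n}([1,P]) ≤ (An)^{Akρ} P^{2k − ½(n²+n)(1−(1−1/n)^ρ)}` for `n ≥ 2`, `k ≥ n² + nρ`,
`P ≥ (An)^{An(1+1/(n−1))^ρ}` (`= VMVTBound A`, `A ≥ 1`), then there are `C ≥ 0`, `c > 0` with
`‖∑_{N<n≤R} (n+u)^{-it}‖ ≤ C N^{1 − c log²N/log²t}` whenever `1 ≤ N < R ≤ 2N`, `N^{10.5} ≤ t`, `0 < u ≤ 1`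
(`VinogradovRangeBound 10 C c`; in fact `c = 1/(2·10⁶)`). [cite: Ivic1985, Theorem 6.2] -/
theorem vinogradovRangeBound_of_vmvt {A : ℝ} (hA : 1 ≤ A)
    (hV : ∀ (n ρ k P : ℕ), 2 ≤ n → n ^ 2 + n * ρ ≤ k →
      (A * n) ^ (A * n * (1 + 1 / ((n : ℝ) - 1)) ^ ρ) ≤ (P : ℝ) →
        (VMV.J n k (Finset.Icc (1 : ℤ) P) : ℝ) ≤
          (A * n) ^ (A * k * ρ) * (P : ℝ) ^ (2 * (k : ℝ) - ((n : ℝ) ^ 2 + n) / 2 * (1 - (1 - 1 / (n : ℝ)) ^ ρ))) :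
    ∃ C c : ℝ, 0 ≤ C ∧ 0 < c ∧ VinogradovRangeBound 10 C c :=
  vinogradovRangeBound_of_vmvtInstance hA (fun n P hn hP => hV n (6 * n) (7 * n ^ 2) P hn (le_of_eq (by ring)) hP)

/-- **The Vinogradov–Korobov zero-free region for Dirichlet `L`-functions from Vinogradov's mean value
theorem**: `hV` (`= VMVTBound A`, `A ≥ 1`) `⟹ ∃ c > 0, HasVKZeroFreeRegion c 21`
(`vinogradovRangeBound_of_vmvt` and `hasVKZeroFreeRegion_of_vinogradovRange`: van der Corput in the small-`λ`
range, Richert-type bounds, Landau's deduction). [cite: Ivic1985, Theorem 6.2] [cite: Ford2002, Theorem 2] -/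
theorem hasVKZeroFreeRegion_of_vmvt {A : ℝ} (hA : 1 ≤ A)
    (hV : ∀ (n ρ k P : ℕ), 2 ≤ n → n ^ 2 + n * ρ ≤ k →
      (A * n) ^ (A * n * (1 + 1 / ((n : ℝ) - 1)) ^ ρ) ≤ (P : ℝ) →
        (VMV.J n k (Finset.Icc (1 : ℤ) P) : ℝ) ≤
          (A * n) ^ (A * k * ρ) * (P : ℝ) ^ (2 * (k : ℝ) - ((n : ℝ) ^ 2 + n) / 2 * (1 - (1 - 1 / (n : ℝ)) ^ ρ))) :
    ∃ c : ℝ, 0 < c ∧ HasVKZeroFreeRegion c 21 := by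
  obtain ⟨C, c, hC, hc, h⟩ := vinogradovRangeBound_of_vmvt hA hV
  exact hasVKZeroFreeRegion_of_vinogradovRange (K := 10) (by norm_num) hC hc h

/-- `vinogradovRangeBound_of_vmvt` with the hypothesis packaged as `VMVTBound A`
(`VinogradovMeanValueHypothesis.lean`). [cite: Ivic1985, Theorem 6.2] -/
theorem vinogradovRangeBound_of_vmvtBound {A : ℝ} (hA : 1 ≤ A) (hV : VMVTBound A) :
    ∃ C c : ℝ, 0 ≤ C ∧ 0 < c ∧ VinogradovRangeBound 10 C c :=
  vinogradovRangeBound_of_vmvt hA hV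

/-- **`VMVTBound A ⟹ ∃ c > 0, HasVKZeroFreeRegion c 21`** (`A ≥ 1`): the Vinogradov–Korobov zero-free region
for all Dirichlet `L`-functions from Vinogradov's mean value theorem in the shape of Ivić's Lemma 6.3.
[cite: Ivic1985, Theorem 6.2] -/
theorem hasVKZeroFreeRegion_of_vmvtBound {A : ℝ} (hA : 1 ≤ A) (hV : VMVTBound A) :
    ∃ c : ℝ, 0 < c ∧ HasVKZeroFreeRegion c 21 :=
  hasVKZeroFreeRegion_of_vmvt hA hV

end VinogradovZetaSum
end Literature.NumberTheory.LFunctions
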